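import Summits.Ventures.Crystal3D.Bulk.GapOrientation
import HarnessLib

/-!
# The oriented face successor and the oriented face corners of the two-level tight map
# (`phase2/LEAN-FACES-DESIGN.md` (F1), sequel of `Bulk/GapOrientation.lean`)

HONEST FRAMING. Part of the venture `Summits/Ventures/Crystal3D` (cell `pub-crystal3d`, phase 2;
seat typer-bulk-2). `Bulk/GapOrientation.lean` fixes the handedness problem of the azimuth
rotation system: `onextNbr c i j` is the counter-clockwise successor (seen from outside) of the
arc `i → j` at EVERY vertex, and `odartGap c i j` the corresponding corner variable. THIS file is
the oriented version of `Bulk/GapDarts.lean` §2 / `Bulk/GapFaceCorners.lean` §3: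

* `ofaceSucc c (i, j) = (j, onextNbr c j i)` — the ORIENTED face successor `φ° = σ° ∘ α`;
  `IsGapConfig.ofaceSucc_mem_darts`, `IsGapConfig.ofaceSucc_injOn`,
  **`IsGapConfig.ofaceSucc_bijOn`** (a permutation of the darts; admissible, `D² < 3`) — its
  orbits are the faces of the DRAWN tight map (each traversed with the face on one fixed side);
* `ofaceCorner c q := odartGap c q.2 q.1` — the corner of the face through the dart `q` at its
  head; `CensusRows.ofaceCorner_eq_corner` (`=` the geometric corner between the incoming and the
  outgoing arc of the oriented walk, `< π`), and **`IsGapConfig.sum_ofaceCorner`**: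
  `Σ_{q ∈ darts c} ofaceCorner c q = 2π · #activeVertices c`.

Nothing is claimed about GAP(1.26); the oriented faces as finsets and Euler's formula are NOT
here.
-/

noncomputable section

open scoped BigOperators InnerProductSpace RealInnerProductSpace
open Finset Real

namespace Summit.Ventures.Crystal3D

open Literature.Geometry.DiscreteGeometry

variable {c : Fin 14 → EuclideanSpace ℝ (Fin 3)}

/-! ## The oriented face successor and the oriented face corners -/

/-- **The oriented face successor** `φ° (i, j) = (j, onextNbr c j i)`: arrive at `j` along
`i → j`, leave along the arc at `j` following `j → i` counter-clockwise (seen from outside). Its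
orbits on the darts are the faces of the drawn tight map traversed with the face on the right. -/
def ofaceSucc (c : Fin 14 → EuclideanSpace ℝ (Fin 3)) (q : Fin 14 × Fin 14) : Fin 14 × Fin 14 :=
  (q.2, onextNbr c q.2 q.1)

/-- The oriented face successor of a dart is a dart (admissible, `D² < 3`). -/
theorem IsGapConfig.ofaceSucc_mem_darts (hc : IsGapConfig c) (hD3 : intruderDist c ^ 2 < 3)
    {q : Fin 14 × Fin 14} (hq : q ∈ darts c) : ofaceSucc c q ∈ darts c := by
  have hq' := swap_mem_darts hq
  have h2 : q.2 ≠ 0 := (mem_darts.1 hq).2.1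
  have hmem := snd_mem_tightNbrs_of_mem_darts hq'
  simp only [Prod.fst_swap, Prod.snd_swap] at hmem
  exact mk_mem_darts h2 (hc.onextNbr_mem hD3 h2 hmem)

/-- The oriented face successor is injective on the darts (admissible, `D² < 3`). -/
theorem IsGapConfig.ofaceSucc_injOn (hc : IsGapConfig c) (hD3 : intruderDist c ^ 2 < 3) :
    Set.InjOn (ofaceSucc c) (darts c : Set (Fin 14 × Fin 14)) := by
  intro q hq q' hq' h
  rw [Finset.mem_coe] at hq hq'
  simp only [ofaceSucc, Prod.mk.injEq] at h
  obtain ⟨h2, hn⟩ := h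
  have hi := snd_mem_tightNbrs_of_mem_darts (swap_mem_darts hq)
  have hi' := snd_mem_tightNbrs_of_mem_darts (swap_mem_darts hq')
  simp only [Prod.fst_swap, Prod.snd_swap] at hi hi'
  have hj0 : q.2 ≠ 0 := (mem_darts.1 hq).2.1
  rw [← h2] at hi' hn
  have h1 : q.1 = q'.1 := hc.onextNbr_injOn hD3 hj0 hi hi' hn
  exact Prod.ext h1 h2

/-- **The oriented face successor is a permutation of the darts** (admissible, `D² < 3`). -/
theorem IsGapConfig.ofaceSucc_bijOn (hc : IsGapConfig c) (hD3 : intruderDist c ^ 2 < 3) :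
    Set.BijOn (ofaceSucc c) (darts c : Set (Fin 14 × Fin 14)) (darts c : Set (Fin 14 × Fin 14)) := by
  have hmaps : Set.MapsTo (ofaceSucc c) (darts c : Set (Fin 14 × Fin 14)) (darts c) :=
    fun q hq => Finset.mem_coe.2 (hc.ofaceSucc_mem_darts hD3 (Finset.mem_coe.1 hq))
  have hinj := hc.ofaceSucc_injOn hD3
  exact ⟨hmaps, hinj, Finset.surjOn_of_injOn_of_card_le _ hmaps hinj le_rfl⟩

/-- **The oriented corner of the face through the dart `q = (i, j)` at its head `j`**: the
oriented gap at `j` following `i` — the angle between the incoming arc `j → i` and the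
outgoing arc `j → onextNbr c j i` of the oriented face walk. -/
def ofaceCorner (c : Fin 14 → EuclideanSpace ℝ (Fin 3)) (q : Fin 14 × Fin 14) : ℝ :=
  odartGap c q.2 q.1

/-- Unfolding `ofaceCorner`. -/
theorem ofaceCorner_eq (c : Fin 14 → EuclideanSpace ℝ (Fin 3)) (q : Fin 14 × Fin 14) :
    ofaceCorner c q = odartGap c q.2 q.1 := rfl

/-- Oriented face corners are positive. -/
theorem ofaceCorner_pos (c : Fin 14 → EuclideanSpace ℝ (Fin 3)) (q : Fin 14 × Fin 14) :
    0 < ofaceCorner c q :=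
  odartGap_pos c q.2 q.1

/-- Under the census socket the oriented face corner at the head of a dart is the geometric
corner between the incoming arc and the outgoing arc of the oriented face walk, and is `< π`. -/
theorem CensusRows.ofaceCorner_eq_corner (h : CensusRows c) {q : Fin 14 × Fin 14}
    (hq : q ∈ darts c) :
    ofaceCorner c q = corner c q.2 (ofaceSucc c q).2 q.1 ∧ ofaceCorner c q < π := by
  have hq' := swap_mem_darts hq
  have hj0 : q.2 ≠ 0 := (mem_darts.1 hq).2.1
  have hi : q.1 ∈ tightNbrs c q.2 := by
    have := snd_mem_tightNbrs_of_mem_darts hq'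
    simpa only [Prod.fst_swap, Prod.snd_swap] using this
  exact ⟨h.odartGap_eq_corner hj0 hi, h.odartGap_lt_pi hj0 hi⟩

/-- **Total oriented corner sum: `Σ_{q ∈ darts c} ofaceCorner c q = 2π · #activeVertices c`**
(admissible, `intruderDist² < 3`). -/
theorem IsGapConfig.sum_ofaceCorner (hc : IsGapConfig c) (hD3 : intruderDist c ^ 2 < 3) :
    ∑ q ∈ darts c, ofaceCorner c q = 2 * π * (activeVertices c).card := by
  classical
  have hmaps : ∀ q ∈ darts c, q.2 ∈ (univ.filter fun j : Fin 14 => j ≠ 0) :=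
    fun q hq => Finset.mem_filter.2 ⟨Finset.mem_univ _, (mem_darts.1 hq).2.1⟩
  rw [← Finset.sum_fiberwise_of_maps_to hmaps]
  have hinner : ∀ j ∈ (univ.filter fun j : Fin 14 => j ≠ 0),
      ∑ q ∈ (darts c).filter (fun q => q.2 = j), ofaceCorner c q =
        if (tightNbrs c j).Nonempty then 2 * π else 0 := by
    intro j hj
    have hj0 : j ≠ 0 := (Finset.mem_filter.1 hj).2
    split_ifs with hne
    · have h1 : ∑ q ∈ (darts c).filter (fun q => q.2 = j), ofaceCorner c q =
          ∑ q ∈ (darts c).filter (fun q => q.2 = j), odartGap c j q.1 := by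
        refine Finset.sum_congr rfl fun q hq => ?_
        rw [ofaceCorner_eq, (Finset.mem_filter.1 hq).2]
      rw [h1, sum_darts_filter_snd c j hj0 (fun i => odartGap c j i)]
      exact hc.sum_odartGap hD3 hj0 hne
    · rw [darts_filter_snd_eq_empty hne, Finset.sum_empty]
  rw [Finset.sum_congr rfl hinner, Finset.sum_ite, Finset.sum_const_zero, add_zero,
    Finset.sum_const, nsmul_eq_mul, mul_comm]
  congr 2
  rw [Finset.filter_filter]
  rfl

/-- Under the census socket: the total oriented corner sum is `2π · #activeVertices c`. -/
theorem CensusRows.sum_ofaceCorner (h : CensusRows c) :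
    ∑ q ∈ darts c, ofaceCorner c q = 2 * π * (activeVertices c).card :=
  h.isGapConfig.sum_ofaceCorner h.intruderDist_bounds.1

end Summit.Ventures.Crystal3D
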